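import Summits.AtomisticToContinuum.Crystallization.Theses.ThreeConeCertificate
import Summits.AtomisticToContinuum.Crystallization.Theorems.SlackRigidity.Negative.WitnessBasics
import Literature.Probability.Process.LocalRubberHardCore
import Literature.MathematicalPhysics.StatisticalMechanics.RootEnergy
import Literature.MathematicalPhysics.StatisticalMechanics.HardCoreGSC
import Literature.MathematicalPhysics.StatisticalMechanics.LennardJonesThermodynamicLimitProofs

/-!
# Skeleton line `ekeland-surgery-parity` for crux `SlackRigidity` (stmt-AtomisticToContinuum-11960)

Route `ThreeConeCertificate`, sub-problem `Crystallization`.  Crux-plan skeleton (planner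
`cruxplan-stmt-AtomisticToContinuum-11960-ekeland-surgery-parity`): five registered stubs `stub_*`
(sorried), the sorry-free composition
`slackRigidity_of_hyps : QuasiRegularisation → HardCoreBSLimit → LocalLimitGSC → UnimodularEnergyBound →
RootLawRigidity → ∃ P, RigidFor P` (standard axioms) and `SlackRigidity_of`, the ONLY theorem of this file whose
conclusion is the route decl `Summit.AtomisticToContinuum.Crystallization.Theses.ThreeConeCertificate.SlackRigidity`
BY NAME (`slackRigidity_iff` of the landed negative module `WitnessBasics` is `Iff.rfl`).

## The line in one paragraph (card `ekeland-surgery-parity`, merged per TRIAGE-r1 with the Hamming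
form of card `ekeland-quasi-ground-states`)

`SlackRigidity` differs from the shared hinge `BulkDefectVanish` (0751) only in its hypothesis: the
sequences are merely `o(N)`-close to `E(N)` in energy, with no Euler–Lagrange structure.  Two free
variational moves restore the structure of ground states IN DENSITY, at a price the `o(N)`-count
conclusion pays without noticing:

* (E/S, `stub_quasiRegularisation`) **Hamming–Ekeland regularisation**: an injective sequence with
  excess `η_N N`, `η_N → 0`, is replaced — changing `≤ √η_N · N = o(N)` particles and never raising the
  energy — by `λ_N`-QUASI-GROUND-STATES (`λ_N → 0`: no relocation of `k` particles gains more than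
  `k λ_N`), which are `1/3`-separated for free (the removal inequality of
  `LennardJonesMinimalDistance_holds` has spare gain `1.39·10⁴ ≫ λ`), and `(R, ε)`-bad counts move by
  `O(#changed) = o(N)` (packing).  The card's separated-ball surgery (S) is then POINTWISE ("no
  `(R, δ)`-improvable particle once `λ_N n_R < δ`") and its `ℓ²`-Ekeland force balance (E) is implied
  at the limit by local minimality; neither needs its own stub.
* (limit, `stub_hardCoreBSLimit` + `stub_localLimitGSC`) Root the regularised configurations at a
  uniformly chosen particle: along a subsequence the rooted empirical laws converge (Benjamini–Schramm)
  to a POINT-STATIONARY probability law `P` on rooted `1/3`-hard-core configurations of `ℝ³`, with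
  `E_P[rootEnergy] = lim 𝓔(x'_N)/N = e_∞` (`BlancLewin2015_8_holds`: `e_∞ = lim E(N)/N` exists) and —
  this is what the parity buys — carried by HARD-CORE GROUND-STATE CONFIGURATIONS in Sütő's sense
  (`IsHardCoreGSC`: no particle-conserving compact modification lowers the energy), because local
  limits of `λ_k`-quasi-ground-states with `λ_k → 0` are GSCs (`stub_localLimitGSC`, the `λ`-robust
  form of item 14086 `LocalLimitStable`).
* (`stub_unimodularEnergyBound`) every point-stationary hard-core probability law has
  `E_P[rootEnergy] ≥ e_∞` (random-grid mass transport + `e_∞ ≤ E(n)/n`, the PROVED half of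
  `BlancLewin2015_8`; the `e_∞`-twin of item 9229), so the limit law is EXACTLY minimising.
* (Transfer `C⁺`, `stub_rootLawRigidity`, LOAD-BEARING) every point-stationary hard-core law that is
  GSC-supported and exactly minimising (`E_P[rootEnergy] = e_∞`) has, for ONE periodic `P₀` (relaxed
  hcp through `0`), almost surely an `(R, ε)`-good root for every `R, ε` — the limit-level content of 0751
  with the competitor class CUT DOWN to exactly minimising equilibrium GSC laws (every ball of every
  sample energy-minimal for its particle number given its exterior; all finite-dimensional KKT
  conditions; force balance).  Density transfer
  (portmanteau clause of the BS stub) and the margin `ε/2 + ε/2 = ε`, `R + 1 → R`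
  (`LocallyMatches.trans`, tree) carry a.s.-goodness back to all but `θ/2 · N` particles —
  contradicting a bad fraction `≥ θ` along the extracted subsequence.

## Disproof used (`Cruxes/SlackRigidity/Disproof.lean` v5, NO KILL; read 2026-08-16)

* `not_rigidForWithoutEnergy` (landed: `Theorems/SlackRigidity/Negative/WitnessBasics.lean`, IMPORTED
  here) — honoured at `stub_quasiRegularisation` (Ekeland's radius is the excess) and again at the
  energy identification `E_P[h] ≤ e_∞` feeding `stub_rootLawRigidity`; the collinear far-spaced witness
  has `E_P[h] = 0 > e_∞`.
* `not_rigidForWithoutRotations` (landed `…/Negative/WithoutRotations.lean`) — honoured: the isometry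
  `A` is OUTPUT by `stub_rootLawRigidity`, per sample, never frozen.
* `zero_mem_points_of_rigidFor`, `norm_le_of_mem_points_of_rigidFor`, `rigidFor_vertexTransitive`,
  `rigidFor_uniformlyDiscrete` (landed `WitnessBasics` / `WitnessTransitive`) — consistent: `C⁺` asks
  root-matching to `A '' P₀.points` at the ROOT of a point-stationary law (a typical point), which for
  an a.s.-`hcp*` law needs exactly the vertex-transitivity `hcpStacking_homogeneous` (Disproof § Sanity).
* `not_forall_rigidFor` — not engaged (`P₀` is `∃`-quantified inside `RootLawRigidity`).
* No stub is an instance of a landed Negative lemma: the three landed modules refute energy-free,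
  rotation-free and `∀ P` variants only; every stub here keeps the energy (as `E_P[h] ≤ e_∞`), outputs
  `A`, and fixes one `P₀`.
* Negatives index: 3506 `OneGrainGluing` (piling; multiplicity-blind matching) — excluded: every
  configuration downstream of `stub_quasiRegularisation` is `1/3`-separated and every law is hard-core;
  4146 `EffectiveLocalHales` — no tolerant local certificate is asserted anywhere.
-/

noncomputable section

open scoped BigOperators Topology
open MeasureTheory Filter Set
open Literature.MathematicalPhysics.StatisticalMechanics
open Literature.Probability.Process
open Summit.AtomisticToContinuum.Crystallization.Theorems.SlackRigidityNegative

namespace Summit.AtomisticToContinuum.Crystallization.Cruxes.SlackRigidity.EkelandSurgeryParity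

/-! ### Vocabulary (documentation; the stub statements inline these so that the registered
signatures mention tree declarations only) -/

/-- **`λ`-quasi-ground-state** (Hamming–Ekeland point; verbatim the sibling card's
`Ekeland.IsQuasiGroundState`): `N` distinct points such that no relocation of `k` particles lowers
the Lennard-Jones energy by more than `k·λ`, `k = #{i : y i ≠ x i}` the Hamming distance.  For
`λ = 0` this is `IsGroundState lennardJones` (`isQuasiGroundState_zero_iff`). -/
def IsQuasiGroundState (lam : ℝ) {N : ℕ} (x : Fin N → E3) : Prop :=
  Function.Injective x ∧ ∀ y : Fin N → E3, Function.Injective y →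
    interactionEnergy lennardJones x - lam * ((Finset.univ.filter fun i => y i ≠ x i).card : ℝ) ≤
      interactionEnergy lennardJones y

/-- Sanity: `0`-quasi-ground-states are exactly the ground states. -/
theorem isQuasiGroundState_zero_iff {N : ℕ} (x : Fin N → E3) :
    IsQuasiGroundState 0 x ↔ IsGroundState lennardJones x := by
  constructor
  · rintro ⟨hx, h⟩
    refine ⟨hx, le_antisymm ?_ (groundStateEnergy_lennardJones_le hx)⟩
    haveI : Nonempty {y : Fin N → E3 // Function.Injective y} := ⟨⟨x, hx⟩⟩
    refine le_ciInf fun y => ?_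
    have := h y.1 y.2
    simpa using this
  · rintro ⟨hx, hE⟩
    refine ⟨hx, fun y hy => ?_⟩
    have := groundStateEnergy_lennardJones_le (d := 3) hy
    simp only [zero_mul, sub_zero]
    linarith

/-- **Root `(R, ε)`-goodness** of a rooted configuration encoded as a measure (points = `atoms`):
its atoms are two-way `ε`-matched on the ball `‖·‖ ≤ R` with a rotated copy `A '' P.points` of the
template — the crux's matching predicate seen from the root (`good_iff`). -/
def RootGood (P : PeriodicConfiguration 3) (R ε : ℝ) (ν : Measure E3) : Prop :=
  ∃ A : E3 →ₗᵢ[ℝ] E3, LocallyMatches R ε (atoms ν) (A '' P.points)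

/-- The crux's matching predicate `Good P R ε x i` (landed negative module, verbatim the predicate
negated inside `SlackRigidity`) is local `(R, ε)`-matching of the configuration recentred at `x i`
with a rotated template. -/
theorem good_iff {P : PeriodicConfiguration 3} {R ε : ℝ} {N : ℕ} {x : Fin N → E3} {i : Fin N} :
    Good P R ε x i ↔
      ∃ A : E3 →ₗᵢ[ℝ] E3, LocallyMatches R ε (Set.range fun j => x j - x i) (A '' P.points) := by
  unfold Good
  refine exists_congr fun A => ?_
  have h := locallyMatches_range_sub_pattern_iff (R := R) (ε := ε) x i A P.points 0
  simp only [sub_zero, dist_zero_right] at h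
  exact h.symm

/-- `Good` is monotone in the tolerance. -/
theorem Good.mono_right {P : PeriodicConfiguration 3} {R ε ε' : ℝ} {N : ℕ} {x : Fin N → E3}
    {i : Fin N} (h : Good P R ε x i) (hε : ε ≤ ε') : Good P R ε' x i := by
  rw [good_iff] at h ⊢
  obtain ⟨A, hA⟩ := h
  exact ⟨A, hA.mono le_rfl hε⟩

/-- Subtype counting on `Fin N`: monotone under implication. -/
theorem natCard_subtype_le {N : ℕ} {p q : Fin N → Prop} (h : ∀ i, p i → q i) :
    Nat.card {i // p i} ≤ Nat.card {i // q i} := by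
  classical
  rw [Nat.card_eq_fintype_card, Nat.card_eq_fintype_card]
  exact Fintype.card_subtype_mono p q h

/-- Subtype counting on `Fin N`: a predicate and its negation exhaust `Fin N`. -/
theorem natCard_subtype_add_compl {N : ℕ} (p : Fin N → Prop) :
    Nat.card {i // p i} + Nat.card {i // ¬ p i} = N := by
  classical
  rw [Nat.card_eq_fintype_card, Nat.card_eq_fintype_card, Fintype.card_subtype_compl,
    Fintype.card_fin]
  have : Fintype.card {i // p i} ≤ N := by
    simpa using Fintype.card_subtype_le p
  omega

/-- Bad counts are antitone in the tolerance. -/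
theorem badCount_anti {P : PeriodicConfiguration 3} {R ε ε' : ℝ} {N : ℕ} (x : Fin N → E3)
    (hε : ε ≤ ε') : badCount P R ε' x ≤ badCount P R ε x :=
  natCard_subtype_le fun i (hb : ¬ Good P R ε' x i) (hg : Good P R ε x i) =>
    hb (Good.mono_right hg hε)

/-- A non-negative real sequence that does not tend to `0` stays above some `θ > 0` frequently. -/
theorem exists_frequently_of_not_tendsto {f : ℕ → ℝ} (hf : ∀ N, 0 ≤ f N)
    (h : ¬ Tendsto f atTop (𝓝 0)) : ∃ θ : ℝ, 0 < θ ∧ ∃ᶠ N in atTop, θ ≤ f N := by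
  by_contra hcon
  push Not at hcon
  apply h
  rw [tendsto_order]
  refine ⟨fun a ha => Eventually.of_forall fun N => ha.trans_le (hf N), fun a ha => ?_⟩
  have := hcon a ha
  simpa [not_frequently, not_le] using this

/-! ### The five stub statements, named

The composition `slackRigidity_of_hyps : QuasiRegularisation → HardCoreBSLimit → LocalLimitGSC →
UnimodularEnergyBound → RootLawRigidity → ∃ P, RigidFor P` is sorry-free; each registered stub `stub_*`
below restates its statement VERBATIM (the kernel checks the agreement inside `SlackRigidity_of`). -/

/-- **Statement of `stub_quasiRegularisation` — Hamming–Ekeland regularisation of near-minimisers**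
(size L, provable now; the merge of card `ekeland-quasi-ground-states`' three first lemmas
`HammingEkeland` (E1), `QuasiGroundStateSeparation` (E2), `BadCountTransfer` (E3) with the choice
`λ_N := min 10⁴ (max √η_N (1/(N+1)))`).  For every template `P`, window `(R, ε)` and every injective
sequence `x^N` with energy excess `η_N N`, `η_N → 0`, there is a modified sequence `x'^N` with:
`x'^N` a `λ_N`-quasi-ground-state (inlined: injective and `𝓔(x') − λ_N·#{i : y i ≠ x' i} ≤ 𝓔(y)` for
every injective `y`), `0 ≤ λ_N → 0`; uniform separation `1/3` (E2: the closest-pair removal gains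
`> 729·229/12 ≈ 1.39·10⁴ ≥ λ_N`, tree `sum_inv_pow_six_le` / proof of
`LennardJonesMinimalDistance_holds`); no energy increase `𝓔(x'^N) ≤ 𝓔(x^N)` (so the excess stays
`o(N)` and `≥ 0`); and `(R, ε)`-bad counts move by `o(N)`:
`badCount(x^N) ≤ badCount(x'^N) + err_N`, `err_N/N → 0` (E3 with the SAME radius: an unchanged
particle that is good in `x'` and has no changed particle within `R + ε` in `x'` nor within `R` in
`x` is good in `x`; packing bound `C(R, ε, 1/3)` per changed index; `#changed ≤ η_N N/λ_N ≤ √η_N N`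
eventually, by E1 = Ekeland in the integer-valued Hamming metric: strong induction on
`⌊(𝓔(x) − E(N))/λ⌋₊`, each improving relocation drops the energy by `> λ`).  Why a stub and not three:
the three lemmas are the natural `--supports` helpers; the line consumes only this conjunction. -/
def QuasiRegularisation : Prop :=
  ∀ (P : PeriodicConfiguration 3) (R ε : ℝ), 0 < R → 0 < ε →
    ∀ x : (N : ℕ) → (Fin N → E3), (∀ N, Function.Injective (x N)) →
      Tendsto (fun N : ℕ => (interactionEnergy lennardJones (x N) -
        groundStateEnergy lennardJones 3 N) / N) atTop (𝓝 0) →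
      ∃ (x' : (N : ℕ) → (Fin N → E3)) (lam : ℕ → ℝ) (err : ℕ → ℝ),
        (∀ N, 0 ≤ lam N) ∧ Tendsto lam atTop (𝓝 0) ∧
        (∀ N, Function.Injective (x' N) ∧ ∀ y : Fin N → E3, Function.Injective y →
          interactionEnergy lennardJones (x' N) -
              lam N * ((Finset.univ.filter fun i => y i ≠ x' N i).card : ℝ) ≤
            interactionEnergy lennardJones y) ∧
        (∀ N (i j : Fin N), i ≠ j → (1 / 3 : ℝ) ≤ dist (x' N i) (x' N j)) ∧
        (∀ N, interactionEnergy lennardJones (x' N) ≤ interactionEnergy lennardJones (x N)) ∧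
        Tendsto (fun N : ℕ => err N / N) atTop (𝓝 0) ∧
        (∀ N, (badCount P R ε (x N) : ℝ) ≤ badCount P R ε (x' N) + err N)

/-- **Statement of `stub_hardCoreBSLimit` — Benjamini–Schramm limit of a hard-core configuration
family** (size XL, soft; potential-blind apart from the `r⁻⁶` tail; the shape of item 9230
`PalmUnimodularRigidity.BenjaminiSchrammLimit` and of the registered stub `stub_bsCompactness` of
`Cruxes/CoarseGrains/Lines/hcp-free-phase-exclusion.lean`, with the GROUND-STATE HYPOTHESIS REMOVED —
it plays no role in the construction — and a support clause added).  For every `δ > 0` and every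
family `x k` of `n k → ∞` points of `ℝ³` that are pairwise `≥ δ` apart there are a subsequence `φ`
and a probability law `P` on rooted configurations (`Measure E3`; points = `atoms`) which is
(i) a.s. rooted `δ`-hard-core (`IsRootedHardCore`), (ii) point-stationary (Mecke identity
`IsPointStationaryLaw` — exact at finite `N` for the uniformly rooted empirical law, closed under weak
limits), (iii) a.s. a LOCAL LIMIT of rooted stages: along a further subsequence `ψ` and roots `i k`
the recentred configurations `x (φ (ψ k)) − x (φ (ψ k)) (i k)` are eventually `(R, ε)`-matched with
`atoms μ` for every `R`, `ε > 0` (support of a weak limit ⊆ Kuratowski limit of the supports, on the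
compact metric space `LocalConfig.RootedHardCoreConfig E3 δ`), (iv) has mean root energy
`∫ rootEnergy V_LJ dP = lim_j 𝓔(x (φ j))/n (φ j)` (exact identity
`interactionEnergy_div_eq_avg_rootEnergy_lennardJones` at finite `N`; `h` is a bounded continuous
local functional under the hard core, `continuous_integral_toMeasure`, tail `≤ C R⁻³`), and (v)
transfers density (portmanteau on the open fattenings `LocalConfig.isOpen_setOf_locallyMatches`):
for every set `T`, radius `R'`, tolerance `ε > 0` and `ρ < P(T)`, eventually at least `ρ · n (φ j)`
particles of `x (φ j)` have their recentred configuration `(R', ε)`-matched with some `ν ∈ T`.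
Hidden Lean cost (as for 9230): `T` is arbitrary (outer measure), so `LocalConfig.toMeasure` on
rooted `δ`-hard-core configurations must be shown a `MeasurableEmbedding`. -/
def HardCoreBSLimit : Prop :=
  ∀ δ : ℝ, 0 < δ → ∀ (n : ℕ → ℕ) (x : (k : ℕ) → (Fin (n k) → E3)), Tendsto n atTop atTop →
    (∀ k (i j : Fin (n k)), i ≠ j → δ ≤ dist (x k i) (x k j)) →
    ∃ φ : ℕ → ℕ, StrictMono φ ∧ ∃ P : Measure (Measure E3),
      IsProbabilityMeasure P ∧ (∀ᵐ μ ∂P, IsRootedHardCore δ μ) ∧ IsPointStationaryLaw P ∧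
      (∀ᵐ μ ∂P, ∃ ψ : ℕ → ℕ, StrictMono ψ ∧ ∃ i : (k : ℕ) → Fin (n (φ (ψ k))),
        ∀ R ε : ℝ, 0 < ε → ∀ᶠ k : ℕ in atTop,
          LocallyMatches R ε
            (Set.range fun j : Fin (n (φ (ψ k))) => x (φ (ψ k)) j - x (φ (ψ k)) (i k)) (atoms μ)) ∧
      Tendsto (fun j : ℕ => interactionEnergy lennardJones (x (φ j)) / (n (φ j) : ℝ)) atTop
        (𝓝 (∫ μ, rootEnergy lennardJones μ ∂P)) ∧
      ∀ (T : Set (Measure E3)) (R' ε : ℝ), 0 < ε → ∀ ρ : ℝ, ρ < (P T).toReal →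
        ∀ᶠ j : ℕ in atTop, ρ * (n (φ j) : ℝ) ≤
          (Nat.card {i : Fin (n (φ j)) // ∃ ν ∈ T,
            LocallyMatches R' ε (Set.range fun k : Fin (n (φ j)) => x (φ j) k - x (φ j) i)
              (atoms ν)} : ℝ)

/-- **Statement of `stub_localLimitGSC` — local limits of quasi-ground-states are ground-state
configurations** (size M–L, provable now; the `λ`-robust form of item 14086 `LocalLimitStable` of
route `GscTwinLoopSurgery`, which is the case `λ ≡ 0`).  If `y k` are `δ`-separated
`λ_k`-quasi-ground-states (inlined) with `λ_k → 0`, translated by arbitrary `c k`, and the point sets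
`y k − c k` converge locally to `S` (eventual `(R, ε)`-matching for every `R`, `ε > 0`), then `S` is
a hard-core canonical GSC of the Lennard-Jones potential (`IsHardCoreGSC`: no exchange of `n` points
of `S` for `n` new distinct points lowers `U + I`).  Proof plan: a competitor `(S ∖ yf) ∪ z` is
realised at stage `k` by relocating the `n` particles matched to `yf` onto `z + c k` (injective for
large `k`: `z` avoids `S ∖ yf`, which is uniformly discrete, and far particles are far); the
quasi-ground-state inequality bounds the gain by `n λ_k → 0`; the energy DIFFERENCE converges by the
exchange identity `two_mul_interactionEnergy_exchange`, continuity of `V_LJ` on `(0, ∞)` for the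
near field and the uniform tail `Σ_{r > L} r⁻⁶ ≤ C L⁻³` for `δ`-separated sets
(`UniformlyDiscrete.summable_lennardJones`, `sum_inv_pow_six_le`).  This is the card's separated-ball
surgery (S) at the level where it is used; force balance (E) follows from it (one-particle moves). -/
def LocalLimitGSC : Prop :=
  ∀ δ : ℝ, 0 < δ → ∀ (n : ℕ → ℕ) (y : (k : ℕ) → (Fin (n k) → E3)) (c : ℕ → E3) (lam : ℕ → ℝ),
    (∀ k, Function.Injective (y k) ∧ ∀ z : Fin (n k) → E3, Function.Injective z →
      interactionEnergy lennardJones (y k) -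
          lam k * ((Finset.univ.filter fun i => z i ≠ y k i).card : ℝ) ≤
        interactionEnergy lennardJones z) →
    Tendsto lam atTop (𝓝 0) →
    (∀ k (i j : Fin (n k)), i ≠ j → δ ≤ dist (y k i) (y k j)) →
    ∀ S : Set E3,
      (∀ R ε : ℝ, 0 < ε → ∀ᶠ k : ℕ in atTop,
        LocallyMatches R ε (Set.range fun i : Fin (n k) => y k i - c k) S) →
      IsHardCoreGSC lennardJones S

/-- **Statement of `stub_unimodularEnergyBound` — no point-stationary hard-core law beats the
thermodynamic limit** (size L, provable now; the `e_∞`-twin of item 9229 `UnimodularEnergyLowerBound`,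
which has `⨅_Q e(Q)` in place of `e_∞` and therefore needs the open periodisation bound).  If
`E(N)/N → e` (so `e = e_∞ = inf_N E(N)/N`, `BlancLewin2015_8_holds`), then every probability law `P`
on rooted configurations of `ℝ³` that is a.s. rooted `δ`-hard-core and point-stationary has
`e ≤ ∫ rootEnergy V_LJ dP`.  Proof plan (card A2 of route PalmUnimodularRigidity, with the PROVED
input `e_∞ ≤ E(n)/n` replacing periodisation): adjoin an independent uniform phase of the grid
`Lℤ³` (the marked law stays point-stationary); transport `(h_y − e)/n_cell` from each point `y` to
the points of its grid cell; the mass received at the root is `(Σ_cell h_y − n e)/n ≥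
−C·n_∂/n − (tail beyond R₀)` because the cell configuration is an `n`-point configuration of
distinct points (`E(n) ≤ Σ_{pairs in cell} V`, hard core bounds the cut bonds per boundary particle,
`r⁻⁶` tail); a second transport gives `E[n_∂/n] = P(root within R₀ of its cell boundary) = O(R₀/L)`;
let `L → ∞`, `R₀ → ∞`.  Junk-safe: if `μ ↦ rootEnergy μ` is not `P`-integrable the integral is `0 ≥ e`
(`e < 0`). -/
def UnimodularEnergyBound : Prop :=
  ∀ e : ℝ, Tendsto (fun N : ℕ => groundStateEnergy lennardJones 3 N / (N : ℝ)) atTop (𝓝 e) →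
    ∀ δ : ℝ, 0 < δ → ∀ P : Measure (Measure E3), IsProbabilityMeasure P →
      (∀ᵐ μ ∂P, IsRootedHardCore δ μ) → IsPointStationaryLaw P →
      e ≤ ∫ μ, rootEnergy lennardJones μ ∂P

/-- **Statement of `stub_rootLawRigidity` — THE LOAD-BEARING STUB (the card's Transfer `C⁺`:
limit-level rigidity of minimising, GSC-supported point-stationary hard-core laws; 0751-hard).**
There is ONE periodic configuration `P₀` (intended: the relaxed Lennard-Jones hcp through `0`) such
that: whenever `e` is the thermodynamic limit `lim E(N)/N` (it exists and is `< 0`: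
`BlancLewin2015_8_holds`), every probability law `P` on rooted configurations of `ℝ³` which is
a.s. rooted `δ`-hard-core, POINT-STATIONARY, a.s. carried by hard-core ground-state configurations
(`IsHardCoreGSC lennardJones (atoms μ)`) and EXACTLY MINIMISING (`∫ rootEnergy V_LJ dP = e`, the least
value a point-stationary hard-core law can have by `stub_unimodularEnergyBound`; the root's own term
is `V_LJ(0) = 0`, `lennardJones_zero`) has, for every `R, ε > 0`, almost surely an
`(R, ε)`-GOOD ROOT: `atoms μ` is two-way `ε`-matched on `‖·‖ ≤ R` with `A '' P₀.points` for some
linear isometry `A` (output per sample — `not_rigidForWithoutRotations`).  Why plausibly true: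
Radin's picture (ground states = minimising invariant measures) predicts that a minimising
point-stationary hard-core law is a.s. a rotated relaxed hcp rooted at one of its points
(`PalmRigidity`, item 9224), and hcp is vertex-transitive under linear isometries
(`hcpStacking_homogeneous`, Disproof § Sanity), so every root is matched with tolerance `0`.  Versus
9224: the OUTPUT is weaker (matching to one template, no identification of `(a, h)` per sample
beyond what a single `P₀` forces) and the INPUT is stronger (GSC support: every ball of every
sample is energy-minimal for its particle number given its exterior — almost-minimality up to
boundary terms at EVERY location and scale, every finite-dimensional KKT condition, force balance —
structure a bare minimising law lacks; zero DENSITY of vacancies / voids / faults comes from `= e`);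
ergodic decomposition is available because both hypotheses pass to components (`= e` because `≥ e`
holds for every component, GSC support because it is an a.s. property).  Why it might fail: exactly
the crux's own risks — a non-vertex-transitive or non-unique (up to `O(3)`) optimal periodic
structure, an aperiodic optimal stacking (Hägg margin `≈ 7·10⁻⁵` uncertified), or an amorphous
minimising GSC phase (barriers `KissingTwelveDegeneracy`, `TetrahedralFrustration`,
`IcosahedralClusters` bite here and only here). -/
def RootLawRigidity : Prop :=
  ∃ P₀ : PeriodicConfiguration 3, ∀ e : ℝ,
    Tendsto (fun N : ℕ => groundStateEnergy lennardJones 3 N / (N : ℝ)) atTop (𝓝 e) →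
    ∀ δ : ℝ, 0 < δ → ∀ P : Measure (Measure E3), IsProbabilityMeasure P →
      (∀ᵐ μ ∂P, IsRootedHardCore δ μ) → IsPointStationaryLaw P →
      (∀ᵐ μ ∂P, IsHardCoreGSC lennardJones (atoms μ)) →
      (∫ μ, rootEnergy lennardJones μ ∂P) = e →
      ∀ R ε : ℝ, 0 < R → 0 < ε →
        ∀ᵐ μ ∂P, ∃ A : E3 →ₗᵢ[ℝ] E3, LocallyMatches R ε (atoms μ) (A '' P₀.points)

/-! ### Registered stubs -/

/-- **stub_quasiRegularisation** — registered stub, statement `QuasiRegularisation` verbatim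
(size L, provable now: Hamming–Ekeland E1 + separation E2 + bad-count transfer E3). -/
theorem stub_quasiRegularisation :
    ∀ (P : PeriodicConfiguration 3) (R ε : ℝ), 0 < R → 0 < ε →
    ∀ x : (N : ℕ) → (Fin N → E3), (∀ N, Function.Injective (x N)) →
      Tendsto (fun N : ℕ => (interactionEnergy lennardJones (x N) -
        groundStateEnergy lennardJones 3 N) / N) atTop (𝓝 0) →
      ∃ (x' : (N : ℕ) → (Fin N → E3)) (lam : ℕ → ℝ) (err : ℕ → ℝ),
        (∀ N, 0 ≤ lam N) ∧ Tendsto lam atTop (𝓝 0) ∧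
        (∀ N, Function.Injective (x' N) ∧ ∀ y : Fin N → E3, Function.Injective y →
          interactionEnergy lennardJones (x' N) -
              lam N * ((Finset.univ.filter fun i => y i ≠ x' N i).card : ℝ) ≤
            interactionEnergy lennardJones y) ∧
        (∀ N (i j : Fin N), i ≠ j → (1 / 3 : ℝ) ≤ dist (x' N i) (x' N j)) ∧
        (∀ N, interactionEnergy lennardJones (x' N) ≤ interactionEnergy lennardJones (x N)) ∧
        Tendsto (fun N : ℕ => err N / N) atTop (𝓝 0) ∧
        (∀ N, (badCount P R ε (x N) : ℝ) ≤ badCount P R ε (x' N) + err N) := by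
  sorry

/-- **stub_hardCoreBSLimit** — registered stub, statement `HardCoreBSLimit` verbatim (size XL, soft;
the hypothesis-free form of item 9230 / `stub_bsCompactness` with the support clause (iii)). -/
theorem stub_hardCoreBSLimit :
    ∀ δ : ℝ, 0 < δ → ∀ (n : ℕ → ℕ) (x : (k : ℕ) → (Fin (n k) → E3)), Tendsto n atTop atTop →
    (∀ k (i j : Fin (n k)), i ≠ j → δ ≤ dist (x k i) (x k j)) →
    ∃ φ : ℕ → ℕ, StrictMono φ ∧ ∃ P : Measure (Measure E3),
      IsProbabilityMeasure P ∧ (∀ᵐ μ ∂P, IsRootedHardCore δ μ) ∧ IsPointStationaryLaw P ∧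
      (∀ᵐ μ ∂P, ∃ ψ : ℕ → ℕ, StrictMono ψ ∧ ∃ i : (k : ℕ) → Fin (n (φ (ψ k))),
        ∀ R ε : ℝ, 0 < ε → ∀ᶠ k : ℕ in atTop,
          LocallyMatches R ε
            (Set.range fun j : Fin (n (φ (ψ k))) => x (φ (ψ k)) j - x (φ (ψ k)) (i k)) (atoms μ)) ∧
      Tendsto (fun j : ℕ => interactionEnergy lennardJones (x (φ j)) / (n (φ j) : ℝ)) atTop
        (𝓝 (∫ μ, rootEnergy lennardJones μ ∂P)) ∧
      ∀ (T : Set (Measure E3)) (R' ε : ℝ), 0 < ε → ∀ ρ : ℝ, ρ < (P T).toReal →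
        ∀ᶠ j : ℕ in atTop, ρ * (n (φ j) : ℝ) ≤
          (Nat.card {i : Fin (n (φ j)) // ∃ ν ∈ T,
            LocallyMatches R' ε (Set.range fun k : Fin (n (φ j)) => x (φ j) k - x (φ j) i)
              (atoms ν)} : ℝ) := by
  sorry

/-- **stub_localLimitGSC** — registered stub, statement `LocalLimitGSC` verbatim (size M–L,
provable now; `λ`-robust `LocalLimitStable`). -/
theorem stub_localLimitGSC :
    ∀ δ : ℝ, 0 < δ → ∀ (n : ℕ → ℕ) (y : (k : ℕ) → (Fin (n k) → E3)) (c : ℕ → E3) (lam : ℕ → ℝ),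
    (∀ k, Function.Injective (y k) ∧ ∀ z : Fin (n k) → E3, Function.Injective z →
      interactionEnergy lennardJones (y k) -
          lam k * ((Finset.univ.filter fun i => z i ≠ y k i).card : ℝ) ≤
        interactionEnergy lennardJones z) →
    Tendsto lam atTop (𝓝 0) →
    (∀ k (i j : Fin (n k)), i ≠ j → δ ≤ dist (y k i) (y k j)) →
    ∀ S : Set E3,
      (∀ R ε : ℝ, 0 < ε → ∀ᶠ k : ℕ in atTop,
        LocallyMatches R ε (Set.range fun i : Fin (n k) => y k i - c k) S) →
      IsHardCoreGSC lennardJones S := by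
  sorry

/-- **stub_unimodularEnergyBound** — registered stub, statement `UnimodularEnergyBound` verbatim
(size L, provable now; `e_∞`-twin of item 9229). -/
theorem stub_unimodularEnergyBound :
    ∀ e : ℝ, Tendsto (fun N : ℕ => groundStateEnergy lennardJones 3 N / (N : ℝ)) atTop (𝓝 e) →
    ∀ δ : ℝ, 0 < δ → ∀ P : Measure (Measure E3), IsProbabilityMeasure P →
      (∀ᵐ μ ∂P, IsRootedHardCore δ μ) → IsPointStationaryLaw P →
      e ≤ ∫ μ, rootEnergy lennardJones μ ∂P := by
  sorry

/-- **stub_rootLawRigidity** — registered stub, statement `RootLawRigidity` verbatim (THE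
LOAD-BEARING STUB, the card's Transfer `C⁺`). -/
theorem stub_rootLawRigidity :
    ∃ P₀ : PeriodicConfiguration 3, ∀ e : ℝ,
    Tendsto (fun N : ℕ => groundStateEnergy lennardJones 3 N / (N : ℝ)) atTop (𝓝 e) →
    ∀ δ : ℝ, 0 < δ → ∀ P : Measure (Measure E3), IsProbabilityMeasure P →
      (∀ᵐ μ ∂P, IsRootedHardCore δ μ) → IsPointStationaryLaw P →
      (∀ᵐ μ ∂P, IsHardCoreGSC lennardJones (atoms μ)) →
      (∫ μ, rootEnergy lennardJones μ ∂P) = e →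
      ∀ R ε : ℝ, 0 < R → 0 < ε →
        ∀ᵐ μ ∂P, ∃ A : E3 →ₗᵢ[ℝ] E3, LocallyMatches R ε (atoms μ) (A '' P₀.points) := by
  sorry

/-! ### The composition (sorry-free) -/

/-- **Core of the composition** (tolerance `ε ≤ 1`): along an injective `o(N)`-excess sequence the
`(R, ε)`-bad fraction w.r.t. `P₀` tends to `0`, given the regularisation, the Benjamini–Schramm
limit, GSC of local limits, the unimodular energy bound and the rigidity of exactly minimising
GSC-supported laws for `P₀`. -/
theorem badFractionVanishes_of_hyps (hReg : QuasiRegularisation) (hBS : HardCoreBSLimit)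
    (hGSC : LocalLimitGSC) (hLow : UnimodularEnergyBound) {P₀ : PeriodicConfiguration 3}
    (hRig : ∀ e : ℝ,
      Tendsto (fun N : ℕ => groundStateEnergy lennardJones 3 N / (N : ℝ)) atTop (𝓝 e) →
      ∀ δ : ℝ, 0 < δ → ∀ P : Measure (Measure E3), IsProbabilityMeasure P →
        (∀ᵐ μ ∂P, IsRootedHardCore δ μ) → IsPointStationaryLaw P →
        (∀ᵐ μ ∂P, IsHardCoreGSC lennardJones (atoms μ)) →
        (∫ μ, rootEnergy lennardJones μ ∂P) = e →
        ∀ R ε : ℝ, 0 < R → 0 < ε →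
          ∀ᵐ μ ∂P, ∃ A : E3 →ₗᵢ[ℝ] E3, LocallyMatches R ε (atoms μ) (A '' P₀.points))
    {R ε : ℝ} (hR : 0 < R) (hε : 0 < ε) (hε1 : ε ≤ 1)
    {x : (N : ℕ) → (Fin N → E3)} (hx : ∀ N, Function.Injective (x N)) (hex : ExcessVanishes x) :
    BadFractionVanishes P₀ R ε x := by
  -- the thermodynamic limit `e = lim E(N)/N` (Blanc–Lewin (8), proved in tree)
  obtain ⟨e, -, he, -⟩ := BlancLewin2015_8_holds 3 (by norm_num) (by norm_num)
  unfold BadFractionVanishes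
  unfold ExcessVanishes at hex
  by_contra hnot
  -- Step 1: Hamming–Ekeland regularisation
  obtain ⟨x', lam, err, -, hlam, hQ, hsep, hE, herr, hbad⟩ := hReg P₀ R ε hR hε x hx hex
  have hnot' : ¬ Tendsto (fun N : ℕ => (badCount P₀ R ε (x' N) : ℝ) / N) atTop (𝓝 0) := by
    intro h'
    apply hnot
    have hup : Tendsto (fun N : ℕ => (badCount P₀ R ε (x' N) : ℝ) / N + err N / N) atTop (𝓝 0) := by
      simpa using h'.add herr
    refine tendsto_of_tendsto_of_tendsto_of_le_of_le tendsto_const_nhds hup (fun N => ?_)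
      (fun N => ?_)
    · positivity
    · show (badCount P₀ R ε (x N) : ℝ) / N ≤ (badCount P₀ R ε (x' N) : ℝ) / N + err N / N
      rw [← add_div]
      exact div_le_div_of_nonneg_right (hbad N) (Nat.cast_nonneg N)
  obtain ⟨θ, hθ, hfreq⟩ := exists_frequently_of_not_tendsto (fun N => by positivity) hnot'
  -- Step 2: a subsequence `ψ` of particle numbers `≥ 1` with bad fraction `≥ θ`
  obtain ⟨ψ, hψ, hψP⟩ := extraction_of_frequently_atTop (hfreq.and_eventually (eventually_ge_atTop 1))
  have hM1 : ∀ k, 1 ≤ ψ k := fun k => (hψP k).2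
  -- Step 3: Benjamini–Schramm limit of the rooted regularised configurations
  obtain ⟨φ, hφ, P, hP, hcore, hstat, hsupp, hEn, htr⟩ :=
    hBS (1 / 3) (by norm_num) ψ (fun k => x' (ψ k)) hψ.tendsto_atTop
      (fun k i j hij => hsep (ψ k) i j hij)
  haveI := hP
  -- Step 4: the limit law is carried by hard-core GSCs (local limits of quasi-ground-states)
  have hgsc : ∀ᵐ μ ∂P, IsHardCoreGSC lennardJones (atoms μ) := by
    filter_upwards [hsupp] with μ hμ
    obtain ⟨ψ', hψ', i, hlim⟩ := hμ
    refine hGSC (1 / 3) (by norm_num) (fun k => ψ (φ (ψ' k))) (fun k => x' (ψ (φ (ψ' k))))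
      (fun k => x' (ψ (φ (ψ' k))) (i k)) (fun k => lam (ψ (φ (ψ' k)))) (fun k => hQ _) ?_
      (fun k a b hab => hsep _ a b hab) (atoms μ) hlim
    exact hlam.comp ((hψ.comp (hφ.comp hψ')).tendsto_atTop)
  -- Step 5: the limit law is minimising, `E_P[h] ≤ e`
  have hEx : Tendsto (fun j : ℕ => interactionEnergy lennardJones (x (ψ (φ j))) / (ψ (φ j) : ℝ))
      atTop (𝓝 e) := by
    have hsub : Tendsto (fun j => ψ (φ j)) atTop atTop := (hψ.comp hφ).tendsto_atTop
    have h1 : Tendsto (fun j : ℕ => groundStateEnergy lennardJones 3 (ψ (φ j)) / (ψ (φ j) : ℝ))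
        atTop (𝓝 e) := he.comp hsub
    have h2 : Tendsto (fun j : ℕ => (interactionEnergy lennardJones (x (ψ (φ j))) -
        groundStateEnergy lennardJones 3 (ψ (φ j))) / (ψ (φ j) : ℝ)) atTop (𝓝 0) := hex.comp hsub
    have h3 := h1.add h2
    rw [add_zero] at h3
    refine h3.congr fun j => ?_
    have hne : (ψ (φ j) : ℝ) ≠ 0 := by
      have : 1 ≤ ψ (φ j) := hM1 _
      exact_mod_cast Nat.one_le_iff_ne_zero.1 this
    field_simp
    ring
  have hElim : (∫ μ, rootEnergy lennardJones μ ∂P) ≤ e :=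
    le_of_tendsto_of_tendsto' hEn hEx fun j =>
      div_le_div_of_nonneg_right (hE _) (Nat.cast_nonneg _)
  -- … and EXACTLY minimising: no point-stationary hard-core law beats `e`
  have hEeq : (∫ μ, rootEnergy lennardJones μ ∂P) = e :=
    le_antisymm hElim (hLow e he (1 / 3) (by norm_num) P hP hcore hstat)
  -- Step 6: rigidity of the limit law — almost surely the root is `(R + 1, ε/2)`-good
  have hgood : ∀ᵐ μ ∂P, ∃ A : E3 →ₗᵢ[ℝ] E3,
      LocallyMatches (R + 1) (ε / 2) (atoms μ) (A '' P₀.points) :=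
    hRig e he (1 / 3) (by norm_num) P hP hcore hstat hgsc hEeq (R + 1) (ε / 2) (by linarith)
      (by linarith)
  -- Step 7: density transfer back to the finite configurations
  set T : Set (Measure E3) :=
    {ν | ∃ A : E3 →ₗᵢ[ℝ] E3, LocallyMatches (R + 1) (ε / 2) (atoms ν) (A '' P₀.points)} with hT
  have hTc : P Tᶜ = 0 := by
    have := ae_iff.1 hgood
    rwa [hT, Set.compl_setOf]
  have hPT : P T = 1 := by
    refine le_antisymm prob_le_one ?_
    calc (1 : ENNReal) = P Set.univ := measure_univ.symm
      _ = P (T ∪ Tᶜ) := by rw [Set.union_compl_self]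
      _ ≤ P T + P Tᶜ := measure_union_le T Tᶜ
      _ = P T := by rw [hTc, add_zero]
  have hρ : 1 - θ / 2 < (P T).toReal := by
    rw [hPT, ENNReal.toReal_one]
    linarith
  obtain ⟨j, hj⟩ := (htr T (R + 1) (ε / 2) (by linarith) (1 - θ / 2) hρ).exists
  -- matched particles are `(R, ε)`-good: margin `ε/2 + ε/2 = ε`, radius `R + 1 → R`
  have hsubset : ∀ i : Fin (ψ (φ j)),
      (∃ ν ∈ T, LocallyMatches (R + 1) (ε / 2)
        (Set.range fun k : Fin (ψ (φ j)) => x' (ψ (φ j)) k - x' (ψ (φ j)) i) (atoms ν)) →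
      Good P₀ R ε (x' (ψ (φ j))) i := by
    rintro i ⟨ν, ⟨A, hA⟩, hm⟩
    rw [good_iff]
    refine ⟨A, ?_⟩
    have h := hm.trans hA (by linarith) (by linarith) (show R + ε / 2 ≤ R + 1 by linarith)
      (show R + ε / 2 ≤ R + 1 by linarith)
    rwa [add_halves] at h
  have hcount : (Nat.card {i : Fin (ψ (φ j)) // ∃ ν ∈ T, LocallyMatches (R + 1) (ε / 2)
      (Set.range fun k : Fin (ψ (φ j)) => x' (ψ (φ j)) k - x' (ψ (φ j)) i) (atoms ν)} : ℝ) ≤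
      Nat.card {i : Fin (ψ (φ j)) // Good P₀ R ε (x' (ψ (φ j))) i} := by
    exact_mod_cast natCard_subtype_le hsubset
  have hsum : (Nat.card {i : Fin (ψ (φ j)) // Good P₀ R ε (x' (ψ (φ j))) i} : ℝ) +
      badCount P₀ R ε (x' (ψ (φ j))) = ψ (φ j) := by
    unfold badCount
    exact_mod_cast natCard_subtype_add_compl (fun i : Fin (ψ (φ j)) => Good P₀ R ε (x' (ψ (φ j))) i)
  have hθj := (hψP (φ j)).1
  have hn : (1 : ℝ) ≤ ψ (φ j) := by exact_mod_cast hM1 (φ j)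
  rw [le_div_iff₀ (by linarith)] at hθj
  nlinarith

/-- Tolerances may be assumed `≤ 1`: goodness is monotone in `ε`. -/
theorem rigidFor_of_le_one {P₀ : PeriodicConfiguration 3}
    (hcore : ∀ R ε : ℝ, 0 < R → 0 < ε → ε ≤ 1 → ∀ x : (N : ℕ) → (Fin N → E3),
      (∀ N, Function.Injective (x N)) → ExcessVanishes x → BadFractionVanishes P₀ R ε x) :
    RigidFor P₀ := by
  intro R ε hR hε x hx hex
  have h := hcore R (min ε 1) hR (lt_min hε one_pos) (min_le_right _ _) x hx hex
  unfold BadFractionVanishes at h ⊢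
  refine tendsto_of_tendsto_of_tendsto_of_le_of_le tendsto_const_nhds h (fun N => ?_) (fun N => ?_)
  · positivity
  · exact div_le_div_of_nonneg_right
      (Nat.cast_le.2 (badCount_anti (P := P₀) (R := R) (x N) (min_le_left ε 1)))
      (Nat.cast_nonneg N)

/-- **Composition** (sorry-free, standard axioms): the five stub statements imply the crux in the
exposed form `∃ P, RigidFor P` of the landed negative module (`slackRigidity_iff : SlackRigidity ↔
∃ P, RigidFor P` is `Iff.rfl`). -/
theorem slackRigidity_of_hyps (hReg : QuasiRegularisation) (hBS : HardCoreBSLimit)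
    (hGSC : LocalLimitGSC) (hLow : UnimodularEnergyBound) (hRig : RootLawRigidity) :
    ∃ P, RigidFor P := by
  obtain ⟨P₀, hP₀⟩ := hRig
  exact ⟨P₀, rigidFor_of_le_one fun R ε hR hε hε1 x hx hex =>
    badFractionVanishes_of_hyps hReg hBS hGSC hLow hP₀ hR hε hε1 hx hex⟩

/-- **The crux BY NAME from the registered stubs.**  The kernel checks here that each `stub_*`
states its named statement verbatim and that the composition reaches the route decl
`ThreeConeCertificate.SlackRigidity`; the only `sorry`s in its cone are the five stubs. -/
theorem SlackRigidity_of :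
    Summit.AtomisticToContinuum.Crystallization.Theses.ThreeConeCertificate.SlackRigidity :=
  slackRigidity_iff.2 (slackRigidity_of_hyps stub_quasiRegularisation stub_hardCoreBSLimit
    stub_localLimitGSC stub_unimodularEnergyBound stub_rootLawRigidity)

end Summit.AtomisticToContinuum.Crystallization.Cruxes.SlackRigidity.EkelandSurgeryParity

end
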